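import Literature.Probability.RandomPlanarGeometry.PlusHullDisplacement
import Literature.Probability.RandomPlanarGeometry.SlitHulls
import Literature.Analysis.Complex.LengthAreaDiameter
import HarnessLib

/-!
# The image of the tip: `U_t = g_t(γ(t))` exists, uniformly in `t` (Lawler's Lemma 4.1/4.2)

G. F. Lawler, *Conformally Invariant Processes in the Plane*, AMS (2005), §4.1: for a simple
curve `γ` with `γ(0) ∈ ℝ`, `γ(0, t] ⊂ ℍ`, and `g_t = g_{γ(0,t]}`, Lemma 4.1 —
"`diam[g_s(γ(s, t])] ≤ c √(diam(γ[0,t₀]) osc(γ, t - s, t₀))`" — and Lemma 4.2 — "there is a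
unique `U_t ∈ ℝ` with `g_t(γ(t)) = U_t` … `t ↦ U_t` is continuous" (there via the Beurling
estimate (3.21)). G. F. Lawler, O. Schramm, W. Werner, *Conformal restriction: the chordal case*
(2003), proof of Lemma 3.5, p. 13: "`U_t := g_t(β(t))`, `Ũ_t := U_t - g_t(0) = Φ_t(β(t))` …
`Ũ_t` is continuous and positive". This file PROVES the existence of the tip image and the
UNIFORM local growth for the tree's maps `E_t = ` Schwarz reflection of `Φ_{γ[0,t]}`
(`IsPlusHull.extMap`), for a slit from a positive real point:

* `IsPlusSlit γ` — the data: `γ` continuous and injective on `[0, 1]`, `γ(0) ∈ (0, ∞)`,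
  `γ(0, 1] ⊆ ℍ`; `IsPlusSlit.hull u = γ[0, u] ∈ 𝒬₊` (`SlitHulls`), `IsPlusSlit.ext u = E_{γ[0,u]}`
  (`u ∈ (0, 1]`), `IsPlusSlit.rad` (a common disc `B̄(γ(0), rad)` containing the slit);
* `IsPlusSlit.norm_ext_sub_ext_le` — **modulus of continuity of `E_u` along connected sets of
  small diameter**, `8π(1 + 6 rad)/√log(1/d)`, UNIFORM in `u` (`LengthAreaDiameter` with the
  displacement bound `|g_u - id| ≤ 6 rad` of `PlusHullDisplacement`) — the substitute for (3.21);
* `IsPlusSlit.tendsto_landing` — **the tip image `Ũ_u = lim_{t ↓ u} E_u(γ(t))` exists**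
  (`IsPlusSlit.landing u`, Cauchy along the curve), is REAL and POSITIVE, indeed
  `Ũ_u ≥ a_u = Φ_u(x₀⁻) > 0` (`landing_im`, `leftVal_le_landing_re`, `landing_re_pos`: it is not a
  value of `E_u` on `Ω_u`, so it lies on the segment `[a_u, b_u]`);
* `IsPlusSlit.uniform_local_growth` — **`sup_{u < t < u + δ} |E_u(γ t) - Ũ_u| → 0` as `δ → 0`,
  uniformly in `u`** (Lawler's Lemma 4.1, first display, with a `1/√log` modulus);
* `IsPlusSlit.norm_landing_sub_le` — `|Ũ_u - γ(0)| ≤ 13 sup_{t ≤ u} |γ(t) - γ(0)|` (start of the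
  driving function: `Ũ_{0+} = γ(0)`).

## References

* G. F. Lawler (2005), §4.1, Lemma 4.1, Lemma 4.2 [Lawler2005].
* [LSW] proof of Lemma 3.5, p. 13 [LawlerSchrammWerner2003Restriction].
-/

noncomputable section

open Set Filter Metric Complex Bornology Function
open _root_.Topology
open UpperHalfPlane (upperHalfPlaneSet isOpen_upperHalfPlaneSet)
open scoped ComplexConjugate

namespace Literature.Probability.RandomPlanarGeometry

/-- **A slit from a positive real point**: `γ : [0, 1] → ℍ̄` continuous and injective with
`γ(0) ∈ (0, ∞)` and `γ(0, 1] ⊆ ℍ` (Lawler (2005), §4.1, "a simple curve with `γ(0) ∈ ℝ` and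
`γ(0, ∞) ⊂ ℍ`", on a compact parameter interval and started on the positive axis as the paths
`β` of [LSW] p. 13). [cite: Lawler2005, §4.1] -/
structure IsPlusSlit (γ : ℝ → ℂ) : Prop where
  continuousOn : ContinuousOn γ (Icc 0 1)
  injOn : InjOn γ (Icc 0 1)
  im_zero : (γ 0).im = 0
  re_pos : 0 < (γ 0).re
  im_pos : ∀ t ∈ Ioc (0 : ℝ) 1, 0 < (γ t).im

namespace IsPlusSlit

variable {γ : ℝ → ℂ} (h : IsPlusSlit γ)

/-! ### The hulls `γ[0, u]` and their maps -/

/-- The initial arc `γ[0, u]`. [folklore] -/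
def hull (_h : IsPlusSlit γ) (u : ℝ) : Set ℂ := γ '' Icc 0 u

/-- Unfolding `hull`. [folklore] -/
theorem hull_def (u : ℝ) : h.hull u = γ '' Icc 0 u := rfl

include h in
/-- `γ(0)` is the real number `re γ(0)`. [folklore] -/
theorem ofReal_re_zero : (((γ 0).re : ℝ) : ℂ) = γ 0 := Complex.ext (by simp) (by simp [h.im_zero])

/-- **`γ[0, u] ∈ 𝒬₊` for `0 < u ≤ 1`** (`isPlusHull_slit`). [cite: Lawler2005, §4.1] -/
theorem isPlusHull {u : ℝ} (hu0 : 0 < u) (hu1 : u ≤ 1) : IsPlusHull (h.hull u) :=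
  isPlusHull_slit hu0 (h.continuousOn.mono (Icc_subset_Icc_right hu1))
    (h.injOn.mono (Icc_subset_Icc_right hu1)) h.im_zero h.re_pos
    fun t ht ↦ h.im_pos t ⟨ht.1, ht.2.trans hu1⟩

/-- `γ[0, u]` is nonempty for `u ≥ 0`. [folklore] -/
theorem hull_nonempty {u : ℝ} (hu : 0 ≤ u) : (h.hull u).Nonempty := (nonempty_Icc.2 hu).image γ

/-- The hulls increase. [folklore] -/
theorem hull_mono {u v : ℝ} (huv : u ≤ v) : h.hull u ⊆ h.hull v := image_mono (Icc_subset_Icc_right huv)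

/-- **The map `E_u`**: the Schwarz-reflected restriction map of `γ[0, u]` for `u ∈ (0, 1]`
(`IsPlusHull.extMap`; `E_u = Φ_{γ[0,u]}` on `ℍ ∖ γ[0,u]`, [LSW] p. 13 "`Φ_t := Φ_{β[0,t]}`"), and
the identity (junk) for other `u`. [cite: LawlerSchrammWerner2003Restriction, proof of Lemma 3.5 (p. 13)] -/
def ext (u : ℝ) : ℂ → ℂ :=
  if hu : 0 < u ∧ u ≤ 1 then (h.isPlusHull hu.1 hu.2).extMap (h.hull_nonempty hu.1.le) else id

/-- `E_u` is the reflected restriction map for `u ∈ (0, 1]`. [folklore] -/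
theorem ext_eq {u : ℝ} (hu0 : 0 < u) (hu1 : u ≤ 1) :
    h.ext u = (h.isPlusHull hu0 hu1).extMap (h.hull_nonempty hu0.le) := by
  simp [ext, hu0, hu1]

include h in
/-- A common disc about `γ(0)` containing the slit (radius `rad > 0`). [folklore] -/
theorem exists_rad : ∃ r : ℝ, 0 < r ∧ γ '' Icc 0 1 ⊆ closedBall (((γ 0).re : ℝ) : ℂ) r := by
  obtain ⟨r, hr, hsub⟩ := (isCompact_Icc.image_of_continuousOn h.continuousOn).isBounded.subset_closedBall_lt
    0 (((γ 0).re : ℝ) : ℂ)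
  exact ⟨r, hr, hsub⟩

/-- The radius of a common disc `B̄(γ(0), rad) ⊇ γ[0, 1]`. [folklore] -/
def rad : ℝ := Classical.choose h.exists_rad

/-- `0 < rad`. [folklore] -/
theorem rad_pos : 0 < h.rad := (Classical.choose_spec h.exists_rad).1

/-- `γ[0, u] ⊆ B̄(γ(0), rad)` for `u ≤ 1`. [folklore] -/
theorem hull_subset_closedBall {u : ℝ} (hu1 : u ≤ 1) : h.hull u ⊆ closedBall (((γ 0).re : ℝ) : ℂ) h.rad :=
  (h.hull_mono hu1).trans (Classical.choose_spec h.exists_rad).2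

/-- Points `γ(t)`, `t > u`, are in `ℍ` and off `γ[0, u]`. [folklore] -/
theorem apply_mem_diff {u t : ℝ} (hu : 0 ≤ u) (hut : u < t) (ht1 : t ≤ 1) :
    γ t ∈ upperHalfPlaneSet \ h.hull u := by
  refine ⟨h.im_pos t ⟨hu.trans_lt hut, ht1⟩, ?_⟩
  rintro ⟨s, hs, hst⟩
  have := h.injOn ⟨hs.1, hs.2.trans (hut.le.trans ht1)⟩ ⟨hu.trans hut.le, ht1⟩ hst
  rw [this] at hs
  exact absurd hs.2 (not_le.2 hut)

/-- The arcs `γ(u, v]` lie in `ℍ ∖ γ[0, u]`. [folklore] -/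
theorem image_Ioc_subset_diff {u v : ℝ} (hu : 0 ≤ u) (hv1 : v ≤ 1) :
    γ '' Ioc u v ⊆ upperHalfPlaneSet \ h.hull u := by
  rintro _ ⟨t, ht, rfl⟩
  exact h.apply_mem_diff hu ht.1 (ht.2.trans hv1)

/-- **Displacement**: `|E_u(z) - z| ≤ 12ρ` on `Ω_u` whenever `γ[0, u] ⊆ B̄(x, ρ)` (`x` real);
in particular `≤ 12 rad`. [cite: Lawler2005, Cor. 3.44 (3.12)] -/
theorem norm_ext_sub_self_le {u : ℝ} (hu0 : 0 < u) (hu1 : u ≤ 1) {x ρ : ℝ} (hρ : 0 < ρ)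
    (hsub : h.hull u ⊆ closedBall (x : ℂ) ρ) {z : ℂ} (hz : z ∈ plusDomain (h.hull u)) :
    ‖h.ext u z - z‖ ≤ 12 * ρ := by
  rw [h.ext_eq hu0 hu1]
  exact (h.isPlusHull hu0 hu1).norm_extMap_sub_self_le (h.hull_nonempty hu0.le) hρ hsub hz

/-! ### The modulus of continuity of `E_u` along small connected sets, uniformly in `u` -/

/-- The uniform modulus `K(d) = 8π(1 + 6 rad)/√log(1/d)`. [folklore] -/
def modulus (d : ℝ) : ℝ := 8 * Real.pi * (1 + 6 * h.rad) / √(Real.log (1 / d))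

/-- `K(d) → 0` as `d → 0+`. [folklore] -/
theorem tendsto_modulus : Tendsto h.modulus (𝓝[>] 0) (𝓝 0) := by
  have h1 : Tendsto (fun d : ℝ ↦ Real.log (1 / d)) (𝓝[>] 0) atTop := by
    have := Real.tendsto_log_atTop.comp tendsto_inv_nhdsGT_zero
    refine this.congr fun d ↦ ?_
    simp [one_div]
  have h2 : Tendsto (fun d : ℝ ↦ √(Real.log (1 / d))) (𝓝[>] 0) atTop :=
    Real.tendsto_sqrt_atTop.comp h1
  have h3 := h2.inv_tendsto_atTop.const_mul (8 * Real.pi * (1 + 6 * h.rad))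
  rw [mul_zero] at h3
  refine h3.congr fun d ↦ ?_
  simp [modulus, div_eq_mul_inv]

/-- For every `ε > 0` there is `d ∈ (0, 1)` with `K(d) ≤ ε`. [folklore] -/
theorem exists_modulus_le {ε : ℝ} (hε : 0 < ε) : ∃ d : ℝ, 0 < d ∧ d < 1 ∧ h.modulus d ≤ ε := by
  have hev : ∀ᶠ d in 𝓝[>] (0 : ℝ), h.modulus d < ε := h.tendsto_modulus (gt_mem_nhds hε)
  have hev' : ∀ᶠ d in 𝓝[>] (0 : ℝ), d < 1 := nhdsWithin_le_nhds (eventually_lt_nhds one_pos)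
  obtain ⟨d, ⟨hd, hd1⟩, hd0⟩ := ((hev.and hev').and eventually_mem_nhdsWithin).exists
  exact ⟨d, hd0, hd1, hd.le⟩

/-- **Modulus of continuity of `E_A` along connected sets of small diameter** for a nonempty
`A ∈ 𝒬₊` in `B̄(x, R)`: `|E_A(z₁) - E_A(z₂)| ≤ 8π(1 + 6R)/√log(1/d)` for `z₁, z₂` in a
preconnected `Q ⊆ (ℍ ∖ A) ∩ B(p, d)`, `0 < d < 1` (`LengthArea.norm_sub_le_of_isPreconnected` for
`g_A = E_A - L : ℍ ∖ A → ℍ`, `|g_A - id| ≤ 6R`). [cite: Lawler2005, Lemma 4.1] -/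
theorem _root_.Literature.Probability.RandomPlanarGeometry.IsPlusHull.norm_extMap_sub_extMap_le
    {A : Set ℂ} (hA : IsPlusHull A) (hne : A.Nonempty) {x R : ℝ} (hR : 0 < R)
    (hsub : A ⊆ closedBall (x : ℂ) R) {Q : Set ℂ} (hQ : IsPreconnected Q)
    (hQU : Q ⊆ upperHalfPlaneSet \ A) {p : ℂ} {d : ℝ} (hd0 : 0 < d) (hd1 : d < 1)
    (hQd : Q ⊆ ball p d) {z₁ z₂ : ℂ} (hz₁ : z₁ ∈ Q) (hz₂ : z₂ ∈ Q) :
    ‖hA.extMap hne z₁ - hA.extMap hne z₂‖ ≤ 8 * Real.pi * (1 + 6 * R) / √(Real.log (1 / d)) := by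
  have hUo : IsOpen (upperHalfPlaneSet \ A) := isOpen_upperHalfPlaneSet.sdiff hA.1.isBoundedHull.isClosed
  have hEU : ∀ z ∈ upperHalfPlaneSet \ A, hA.extMap hne z = hA.baseMap hne z := fun z hz ↦
    hA.extMap_of_mem_diff hne hz
  have hshift : ∀ {w : ℂ}, w ∈ upperHalfPlaneSet → w + (hA.extShift hne : ℂ) ∈ upperHalfPlaneSet :=
    fun hw ↦ by show 0 < (_ + ((hA.extShift hne : ℝ) : ℂ)).im; simpa using hw
  have key := Literature.Analysis.Complex.LengthArea.norm_sub_le_of_isPreconnected hUo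
    (g := fun z ↦ hA.extMap hne z - hA.extShift hne)
    (f := fun w ↦ (hA.baseMap hne).symm (w + hA.extShift hne)) (C₀ := 6 * R)
    (((hA.differentiableOn_extMap hne).mono hA.diff_subset_plusDomain).sub_const _)
    (fun z hz ↦ by
      show 0 < (hA.extMap hne z - hA.extShift hne).im
      have := hA.extMap_mem_of_mem_diff hne hz
      simpa using this)
    (fun w hw ↦ (hA.baseMap hne).symm_mapsTo (hshift hw))
    ((hA.baseMap hne).symm.continuousOn.comp (continuousOn_id.add continuousOn_const) fun w hw ↦ hshift hw)
    (fun w hw ↦ by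
      show hA.extMap hne ((hA.baseMap hne).symm (w + hA.extShift hne)) - hA.extShift hne = w
      rw [hEU _ ((hA.baseMap hne).symm_mapsTo (hshift hw)), (hA.baseMap hne).apply_symm_apply (hshift hw)]
      ring)
    (fun z hz ↦ by
      show (hA.baseMap hne).symm (hA.extMap hne z - hA.extShift hne + hA.extShift hne) = z
      rw [sub_add_cancel, hEU z hz, (hA.baseMap hne).symm_apply_apply hz])
    (fun z hz ↦ hA.norm_extMap_sub_extShift_sub_le hne hR hsub (hA.diff_subset_plusDomain hz))
    hd0 hd1 hQ hQU hQd hz₁ hz₂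
  have heq : (hA.extMap hne z₁ - hA.extShift hne) - (hA.extMap hne z₂ - hA.extShift hne) =
      hA.extMap hne z₁ - hA.extMap hne z₂ := by ring
  rw [heq] at key
  exact key

/-- **Modulus of continuity of `E_u` along connected sets of small diameter, uniformly in `u`**
(Lawler (2005), Lemma 4.1, first display, with the modulus of `LengthAreaDiameter`): for
`u ∈ (0, 1]`, a preconnected `Q ⊆ ℍ ∖ γ[0, u]` with `Q ⊆ B(p, d)`, `0 < d < 1`, and
`z₁, z₂ ∈ Q`: `|E_u(z₁) - E_u(z₂)| ≤ K(d)`. [cite: Lawler2005, Lemma 4.1] -/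
theorem norm_ext_sub_ext_le {u : ℝ} (hu0 : 0 < u) (hu1 : u ≤ 1) {Q : Set ℂ} (hQ : IsPreconnected Q)
    (hQU : Q ⊆ upperHalfPlaneSet \ h.hull u) {p : ℂ} {d : ℝ} (hd0 : 0 < d) (hd1 : d < 1)
    (hQd : Q ⊆ ball p d) {z₁ z₂ : ℂ} (hz₁ : z₁ ∈ Q) (hz₂ : z₂ ∈ Q) :
    ‖h.ext u z₁ - h.ext u z₂‖ ≤ h.modulus d := by
  rw [h.ext_eq hu0 hu1]
  exact (h.isPlusHull hu0 hu1).norm_extMap_sub_extMap_le (h.hull_nonempty hu0.le) h.rad_pos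
    (h.hull_subset_closedBall hu1) hQ hQU hd0 hd1 hQd hz₁ hz₂

/-! ### The tip image `Ũ_u` -/

include h in
/-- Uniform continuity of `γ` on `[0, 1]`. [folklore] -/
theorem exists_forall_norm_sub_lt {ε : ℝ} (hε : 0 < ε) :
    ∃ δ : ℝ, 0 < δ ∧ ∀ s ∈ Icc (0 : ℝ) 1, ∀ t ∈ Icc (0 : ℝ) 1, |s - t| < δ → ‖γ s - γ t‖ < ε := by
  have huc := isCompact_Icc.uniformContinuousOn_of_continuous h.continuousOn
  obtain ⟨δ, hδ, hγ⟩ := Metric.uniformContinuousOn_iff.1 huc ε hε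
  exact ⟨δ, hδ, fun s hs t ht hst ↦ by
    have := hγ s hs t ht (by rwa [Real.dist_eq])
    rwa [dist_eq_norm] at this⟩

/-- The arcs `γ(u, t]` with `t - u < δ` (`δ` from uniform continuity at scale `d`) are
preconnected subsets of `ℍ ∖ γ[0, u]` inside `B(γ(u), d)`. [folklore] -/
theorem image_Ioc_good {u t d δ : ℝ} (hu : 0 ≤ u) (hut : u ≤ t) (ht1 : t ≤ 1) (htδ : t < u + δ)
    (hδ : ∀ s ∈ Icc (0 : ℝ) 1, ∀ s' ∈ Icc (0 : ℝ) 1, |s - s'| < δ → ‖γ s - γ s'‖ < d) :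
    IsPreconnected (γ '' Ioc u t) ∧ γ '' Ioc u t ⊆ upperHalfPlaneSet \ h.hull u ∧
      γ '' Ioc u t ⊆ ball (γ u) d := by
  refine ⟨isPreconnected_Ioc.image _ (h.continuousOn.mono fun s hs ↦ ⟨hu.trans hs.1.le, hs.2.trans ht1⟩),
    h.image_Ioc_subset_diff hu ht1, ?_⟩
  rintro _ ⟨s, hs, rfl⟩
  rw [mem_ball, dist_eq_norm]
  exact hδ s ⟨hu.trans hs.1.le, hs.2.trans ht1⟩ u ⟨hu, hut.trans ht1⟩
    (by rw [abs_of_nonneg (by linarith [hs.1])]; linarith [hs.2])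

/-- **The tip image exists**: `E_u(γ(t))` converges as `t ↓ u`, for `u ∈ (0, 1)` (Cauchy along
the curve by `norm_ext_sub_ext_le`; Lawler (2005), Lemma 4.2). [cite: Lawler2005, Lemma 4.2] -/
theorem exists_tendsto_ext_apply {u : ℝ} (hu0 : 0 < u) (hu1 : u < 1) :
    ∃ p : ℂ, Tendsto (fun t ↦ h.ext u (γ t)) (𝓝[>] u) (𝓝 p) := by
  have hC : Cauchy (map (fun t ↦ h.ext u (γ t)) (𝓝[>] u)) := by
    rw [Metric.cauchy_iff]
    refine ⟨inferInstance, fun ε hε ↦ ?_⟩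
    obtain ⟨d, hd0, hd1, hdε⟩ := h.exists_modulus_le (half_pos hε)
    obtain ⟨δ, hδ, hγδ⟩ := h.exists_forall_norm_sub_lt hd0
    set t₀ : ℝ := min (u + δ / 2) 1 with ht₀
    have hut₀ : u < t₀ := lt_min (by linarith) hu1
    refine ⟨(fun t ↦ h.ext u (γ t)) '' Ioc u t₀, image_mem_map (Ioc_mem_nhdsGT hut₀), ?_⟩
    rintro _ ⟨t, ht, rfl⟩ _ ⟨t', ht', rfl⟩
    obtain ⟨hQ, hQU, hQd⟩ := h.image_Ioc_good (d := d) hu0.le hut₀.le (min_le_right _ _)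
      (by linarith [min_le_left (u + δ / 2) 1]) hγδ
    rw [dist_eq_norm]
    exact (h.norm_ext_sub_ext_le hu0 hu1.le hQ hQU hd0 hd1 hQd ⟨t, ht, rfl⟩ ⟨t', ht', rfl⟩).trans_lt
      (by linarith)
  obtain ⟨p, hp⟩ := CompleteSpace.complete hC
  exact ⟨p, hp⟩

/-- **The tip image `Ũ_u`** (`= lim_{t ↓ u} E_u(γ(t))` for `u ∈ (0, 1)`; junk `γ(0)` otherwise):
Lawler's `U_t = g_t(γ(t))` (Lemma 4.2) in the normalization `Φ_t` of [LSW] p. 13 ("`Ũ_t := Φ_t(β(t))`").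
[cite: LawlerSchrammWerner2003Restriction, proof of Lemma 3.5 (p. 13)] -/
def landing (u : ℝ) : ℂ :=
  if hu : 0 < u ∧ u < 1 then Classical.choose (h.exists_tendsto_ext_apply hu.1 hu.2) else γ 0

/-- `E_u(γ(t)) → Ũ_u` as `t ↓ u`. [cite: Lawler2005, Lemma 4.2] -/
theorem tendsto_landing {u : ℝ} (hu0 : 0 < u) (hu1 : u < 1) :
    Tendsto (fun t ↦ h.ext u (γ t)) (𝓝[>] u) (𝓝 (h.landing u)) := by
  simp only [landing, hu0, hu1, and_self, ↓reduceDIte]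
  exact Classical.choose_spec (h.exists_tendsto_ext_apply hu0 hu1)

/-- **Uniform local growth** (Lawler (2005), Lemma 4.1, first display, with a `1/√log` modulus):
for every `ε > 0` there is `δ > 0` such that `|E_u(γ(t)) - Ũ_u| ≤ ε` for ALL `u ∈ (0, 1)` and
`t ∈ (u, u + δ)`, `t ≤ 1`. [cite: Lawler2005, Lemma 4.1] -/
theorem uniform_local_growth {ε : ℝ} (hε : 0 < ε) :
    ∃ δ : ℝ, 0 < δ ∧ ∀ u : ℝ, 0 < u → u < 1 → ∀ t : ℝ, u < t → t ≤ 1 → t < u + δ →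
      ‖h.ext u (γ t) - h.landing u‖ ≤ ε := by
  obtain ⟨d, hd0, hd1, hdε⟩ := h.exists_modulus_le hε
  obtain ⟨δ, hδ, hγδ⟩ := h.exists_forall_norm_sub_lt hd0
  refine ⟨δ, hδ, fun u hu0 hu1 t hut ht1 htδ ↦ ?_⟩
  obtain ⟨hQ, hQU, hQd⟩ := h.image_Ioc_good (d := d) hu0.le hut.le ht1 htδ hγδ
  have hlim : Tendsto (fun t' ↦ ‖h.ext u (γ t) - h.ext u (γ t')‖) (𝓝[>] u)
      (𝓝 ‖h.ext u (γ t) - h.landing u‖) :=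
    (tendsto_const_nhds.sub (h.tendsto_landing hu0 hu1)).norm
  refine le_of_tendsto hlim ?_
  filter_upwards [Ioc_mem_nhdsGT hut] with t' ht'
  exact (h.norm_ext_sub_ext_le hu0 hu1.le hQ hQU hd0 hd1 hQd ⟨t, ⟨hut, le_rfl⟩, rfl⟩ ⟨t', ht', rfl⟩).trans hdε

include h in
/-- `γ(t) → γ(u)` as `t ↓ u` (`u < 1`). [folklore] -/
theorem tendsto_apply_nhdsGT {u : ℝ} (hu0 : 0 ≤ u) (hu1 : u < 1) : Tendsto γ (𝓝[>] u) (𝓝 (γ u)) := by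
  have hc : ContinuousWithinAt γ (Icc 0 1) u := h.continuousOn u ⟨hu0, hu1.le⟩
  rw [← nhdsWithin_Ioc_eq_nhdsGT hu1]
  exact hc.tendsto.mono_left (nhdsWithin_mono _ fun t ht ↦ ⟨hu0.trans ht.1.le, ht.2⟩)

/-- **`Ũ_u` lies on the segment `[a_u, b_u]`** (it is not a value of `E_u` on `Ω_u`: otherwise
`γ(t) = E_u⁻¹(E_u(γ t)) → E_u⁻¹(Ũ_u) ∈ Ω_u`, but `γ(t) → γ(u) ∈ γ[0, u]`). [folklore] -/
theorem landing_mem_valSeg {u : ℝ} (hu0 : 0 < u) (hu1 : u < 1) :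
    h.landing u ∈ (h.isPlusHull hu0 hu1.le).valSeg (h.hull_nonempty hu0.le) := by
  set hA := h.isPlusHull hu0 hu1.le
  set hne := h.hull_nonempty hu0.le
  by_contra hmem
  have hinv : ContinuousAt (hA.invExt hne) (h.landing u) := hA.continuousAt_invExt hne hmem
  have h1 : Tendsto (fun t ↦ hA.invExt hne (h.ext u (γ t))) (𝓝[>] u) (𝓝 (hA.invExt hne (h.landing u))) :=
    hinv.tendsto.comp (h.tendsto_landing hu0 hu1)
  have h2 : Tendsto (fun t ↦ hA.invExt hne (h.ext u (γ t))) (𝓝[>] u) (𝓝 (γ u)) := by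
    refine (h.tendsto_apply_nhdsGT hu0.le hu1).congr' ?_
    filter_upwards [Ioo_mem_nhdsGT hu1] with t ht
    rw [h.ext_eq hu0 hu1.le, hA.invExt_extMap hne (hA.diff_subset_plusDomain (h.apply_mem_diff hu0.le ht.1 ht.2.le))]
  have heq : hA.invExt hne (h.landing u) = γ u := tendsto_nhds_unique h1 h2
  have hmemΩ : γ u ∈ plusDomain (h.hull u) := by rw [← heq]; exact hA.invExt_mem hne hmem
  exact hmemΩ (Or.inl (Or.inl ⟨u, ⟨hu0.le, le_rfl⟩, rfl⟩))

/-- **`Ũ_u` is real.** [cite: Lawler2005, Lemma 4.2] -/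
theorem landing_im {u : ℝ} (hu0 : 0 < u) (hu1 : u < 1) : (h.landing u).im = 0 :=
  (((h.isPlusHull hu0 hu1.le).mem_valSeg_iff (h.hull_nonempty hu0.le)).1 (h.landing_mem_valSeg hu0 hu1)).1

/-- `a_u ≤ Ũ_u` (`a_u = Φ_u(x₀⁻)`, the left end of the image of the two sides of the slit). [folklore] -/
theorem leftVal_le_landing_re {u : ℝ} (hu0 : 0 < u) (hu1 : u < 1) :
    (h.isPlusHull hu0 hu1.le).leftVal (h.hull_nonempty hu0.le) ≤ (h.landing u).re :=
  (((h.isPlusHull hu0 hu1.le).mem_valSeg_iff (h.hull_nonempty hu0.le)).1 (h.landing_mem_valSeg hu0 hu1)).2.1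

/-- **`Ũ_u > 0`** ([LSW] p. 13: "`Ũ_t` is … positive"): `Ũ_u ≥ a_u > Φ_u(0) = 0`. [cite: LawlerSchrammWerner2003Restriction, proof of Lemma 3.5 (p. 13)] -/
theorem landing_re_pos {u : ℝ} (hu0 : 0 < u) (hu1 : u < 1) : 0 < (h.landing u).re :=
  lt_of_lt_of_le ((h.isPlusHull hu0 hu1.le).leftVal_pos (h.hull_nonempty hu0.le)) (h.leftVal_le_landing_re hu0 hu1)

/-- `Ũ_u` as a complex number is `re Ũ_u`. [folklore] -/
theorem landing_eq_ofReal {u : ℝ} (hu0 : 0 < u) (hu1 : u < 1) : h.landing u = (((h.landing u).re : ℝ) : ℂ) :=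
  Complex.ext (by simp) (by simp [h.landing_im hu0 hu1])

/-- **The start of the driving function**: if `|γ(t) - γ(0)| ≤ ρ` on `[0, u]` then
`|Ũ_u - γ(0)| ≤ 13ρ` (displacement `≤ 12ρ` for the hull `γ[0, u] ⊆ B̄(γ(0), ρ)`, and
`|γ(u) - γ(0)| ≤ ρ`). [cite: Lawler2005, Lemma 4.2] -/
theorem norm_landing_sub_le {u : ℝ} (hu0 : 0 < u) (hu1 : u < 1) {ρ : ℝ} (hρ : 0 < ρ)
    (hγρ : ∀ t ∈ Icc 0 u, ‖γ t - γ 0‖ ≤ ρ) : ‖h.landing u - γ 0‖ ≤ 13 * ρ := by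
  have hsub : h.hull u ⊆ closedBall (((γ 0).re : ℝ) : ℂ) ρ := by
    rintro _ ⟨t, ht, rfl⟩
    rw [mem_closedBall, dist_eq_norm, h.ofReal_re_zero]
    exact hγρ t ht
  have hlim : Tendsto (fun t ↦ ‖h.ext u (γ t) - γ t‖) (𝓝[>] u) (𝓝 ‖h.landing u - γ u‖) :=
    ((h.tendsto_landing hu0 hu1).sub (h.tendsto_apply_nhdsGT hu0.le hu1)).norm
  have h1 : ‖h.landing u - γ u‖ ≤ 12 * ρ := by
    refine le_of_tendsto hlim ?_
    filter_upwards [Ioo_mem_nhdsGT hu1] with t ht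
    exact h.norm_ext_sub_self_le hu0 hu1.le hρ hsub
      ((h.isPlusHull hu0 hu1.le).diff_subset_plusDomain (h.apply_mem_diff hu0.le ht.1 ht.2.le))
  have h2 : ‖γ u - γ 0‖ ≤ ρ := hγρ u ⟨hu0.le, le_rfl⟩
  calc ‖h.landing u - γ 0‖ = ‖(h.landing u - γ u) + (γ u - γ 0)‖ := by ring_nf
    _ ≤ ‖h.landing u - γ u‖ + ‖γ u - γ 0‖ := norm_add_le _ _
    _ ≤ 12 * ρ + ρ := add_le_add h1 h2
    _ = 13 * ρ := by ring

end IsPlusSlit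

end Literature.Probability.RandomPlanarGeometry
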